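import Mathlib.Data.Fintype.Powerset
import Literature.Computability.AlgebraicComplexity.GrenetEquivariant

/-!
# `ProjectionStability.OptStep` (stmt-ValiantsHypothesis-17835), line `Sketch` — stub S2:
# Grenet's matrix is a strict projection of the determinant

`IsDetProjection f m` (Valiant's projection model) asks for an `m × m` matrix whose every cell is a
variable `X v` or a constant `C c` and whose determinant is `f`.  Grenet's affine matrix
`Grenet.repr k n e` (the `(univ, ∅)` minor of `1 - adj` for the weighted adjacency matrix `adj` of
the subset lattice of `Fin n`, reindexed along `e : Finset (Fin n) ≃ Fin 2ⁿ`, times the sign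
`(-1) ^ (e univ + e ∅)`) has determinant `per_n` for every `e` (`Grenet.isAffineDetRepr_repr`, in
tree).  Its cells are `±1` (diagonal: `adj S S = 0`), `0`, or `∓ X (j, |S|)` (row `S ≠ univ`,
column `insert j S`; the inserted `j` is unique), the upper sign being that of
`(-1) ^ (e univ + e ∅)`.  So for an enumeration `e` with `e univ + e ∅` ODD every cell is
`X (j, |S|)`, `C (-1)` or `C 0` — a strict projection — and such an `e` exists as soon as `n ≥ 1`
(`univ ≠ ∅`: send `∅ ↦ 0`, `univ ↦ 1`).

* `neg_one_sub_adj_apply` — the cells of `-(1 - adj)` are variables or constants.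
* `repr_apply_of_odd`, `repr_apply_isVarOrConst` — hence so are the cells of `Grenet.repr k n e`
  when `e univ + e ∅` is odd.
* `exists_equiv_odd` — an enumeration with `e univ + e ∅ = 1` (`n ≥ 1`).
* `isDetProjection_of_odd`, `isDetProjection_perPoly` — `IsDetProjection per_n N` for
  `2 ^ n = N + 1`.
* `stub_grenetProjection` — the registered signature (`N := 2 ^ n - 1`): `pdc(per_n) ≤ 2ⁿ - 1`
  in Valiant's projection model, the strict form of Grenet's `dc(per_n) ≤ 2ⁿ - 1`.

Sources: B. Grenet, *An upper bound for the permanent versus determinant problem* (2011), Thm. 1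
(key `Grenet2011`); L. G. Valiant, *Completeness classes in algebra*, STOC 1979, §2.  Not here:
the other stubs of the line (equivariance, gauge rigidity, transport, the symmetry step).
-/

-- single-conjunct layout: Sub = Summit, duplicated namespace component intended
set_option linter.dupNamespace false

noncomputable section

namespace Summit.ValiantsHypothesis.ValiantsHypothesis.Theorems.ProjectionStabilityOptStep.GrenetProjection

open MvPolynomial Matrix Finset
open Literature.Computability.AlgebraicComplexity

variable (k : Type*) [CommRing k]

/-- **The cells of `-(1 - adj)` are variables or constants.**  For Grenet's weighted adjacency
matrix `adj` of the subset lattice of `Fin n` (arc `S → insert j S` of weight `X (j, |S|)`):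
`-(1 - adj) S S = -1` (no arc is a loop), `-(1 - adj) S (insert j S) = X (j, |S|)` for `j ∉ S`
(the inserted element is unique, and `|S| < n`), and every other cell is `0`.
[cite: Grenet2011, Thm. 1] -/
theorem neg_one_sub_adj_apply (n : ℕ) (S T : Finset (Fin n)) :
    (∃ v, -((1 - Grenet.adj k n) S T) = X v) ∨ ∃ c, -((1 - Grenet.adj k n) S T) = C c := by
  -- adapted from Summits/ValiantsHypothesis/ValiantsHypothesis/Theorems/
  -- DetQPDetqpThesisStubGrenetRowPartitioned.lean (row bookkeeping of Grenet's matrix)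
  rw [Matrix.sub_apply, Matrix.one_apply, Grenet.adj_apply, neg_sub]
  by_cases hST : S = T
  · subst hST
    refine Or.inr ⟨-1, ?_⟩
    have h0 : (∑ j, if j ∉ S ∧ S = insert j S then Grenet.wt k n j S.card else 0) = 0 :=
      Finset.sum_eq_zero fun j _ => if_neg fun h => (Finset.insert_ne_self.mpr h.1) h.2.symm
    rw [if_pos rfl, h0, zero_sub, map_neg, map_one]
  · rw [if_neg hST, sub_zero]
    by_cases h : ∃ j, j ∉ S ∧ T = insert j S
    · obtain ⟨j, hj, rfl⟩ := h
      refine Or.inl ⟨(j, ⟨S.card, Grenet.card_lt_of_notMem hj⟩), ?_⟩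
      rw [Finset.sum_eq_single j]
      · rw [if_pos ⟨hj, rfl⟩, Grenet.wt, dif_pos (Grenet.card_lt_of_notMem hj)]
      · intro b _ hbj
        refine if_neg fun hb => ?_
        have hmem : b ∈ insert j S := hb.2 ▸ mem_insert_self b S
        rcases mem_insert.mp hmem with hb' | hb'
        · exact hbj hb'
        · exact hb.1 hb'
      · exact fun hj' => absurd (mem_univ j) hj'
    · refine Or.inr ⟨0, ?_⟩
      rw [map_zero]
      exact Finset.sum_eq_zero fun j _ => if_neg fun hj => h ⟨j, hj⟩

/-- When `e univ + e ∅` is odd the sign of `Grenet.repr` is `-1`: its `(p, q)` cell is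
`-(1 - adj) S T` for the subsets `S = e⁻¹ ((e univ).succAbove p)` (row) and
`T = e⁻¹ ((e ∅).succAbove q)` (column). [cite: Grenet2011, Thm. 1] -/
theorem repr_apply_of_odd {n N : ℕ} (e : Finset (Fin n) ≃ Fin (N + 1))
    (he : Odd ((e univ : ℕ) + (e ∅ : ℕ))) (p q : Fin N) :
    Grenet.repr k n e p q =
      -((1 - Grenet.adj k n) (e.symm ((e univ).succAbove p)) (e.symm ((e ∅).succAbove q))) := by
  rw [Grenet.repr, he.neg_one_pow, Matrix.smul_apply, Matrix.submatrix_apply,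
    Matrix.submatrix_apply, smul_eq_mul, neg_one_mul]

/-- **Grenet's matrix is a strict projection matrix when `e univ + e ∅` is odd**: every cell of
`Grenet.repr k n e` is a variable `X (j, c)` or a constant (`-1` or `0`).
[cite: Grenet2011, Thm. 1] -/
theorem repr_apply_isVarOrConst {n N : ℕ} (e : Finset (Fin n) ≃ Fin (N + 1))
    (he : Odd ((e univ : ℕ) + (e ∅ : ℕ))) (p q : Fin N) :
    (∃ v, Grenet.repr k n e p q = X v) ∨ ∃ c, Grenet.repr k n e p q = C c := by
  rw [repr_apply_of_odd k e he]
  exact neg_one_sub_adj_apply k n _ _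

/-- For `n ≥ 1` (so that `univ ≠ ∅` in `Finset (Fin n)`) and `2 ^ n = N + 1` there is an
enumeration `e : Finset (Fin n) ≃ Fin (N + 1)` with `e univ = 1` and `e ∅ = 0`, hence with
`e univ + e ∅ = 1` odd (swap `∅` to `0`, then `univ` to `1`). [folklore] -/
theorem exists_equiv_odd {n N : ℕ} (hn : 1 ≤ n) (hN : 2 ^ n = N + 1) :
    ∃ e : Finset (Fin n) ≃ Fin (N + 1), (e univ : ℕ) + (e ∅ : ℕ) = 1 := by
  have hcard : Fintype.card (Finset (Fin n)) = N + 1 := by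
    rw [Fintype.card_finset, Fintype.card_fin, hN]
  have h1N : 1 < N + 1 := hN ▸ Nat.one_lt_two_pow (by omega)
  haveI : Nonempty (Fin n) := ⟨⟨0, hn⟩⟩
  have hne : (univ : Finset (Fin n)) ≠ ∅ := univ_nonempty.ne_empty
  have h01 : (0 : Fin (N + 1)) ≠ ⟨1, h1N⟩ := Fin.ne_of_val_ne (by simp)
  obtain ⟨e₀⟩ : Nonempty (Finset (Fin n) ≃ Fin (N + 1)) := ⟨Fintype.equivFinOfCardEq hcard⟩
  obtain ⟨e₁, h₁⟩ : ∃ e₁ : Finset (Fin n) ≃ Fin (N + 1), e₁ ∅ = 0 :=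
    ⟨e₀.trans (Equiv.swap (e₀ ∅) 0), by simp⟩
  refine ⟨e₁.trans (Equiv.swap (e₁ univ) ⟨1, h1N⟩), ?_⟩
  have hu : (e₁.trans (Equiv.swap (e₁ univ) ⟨1, h1N⟩)) univ = ⟨1, h1N⟩ := by simp
  have h0 : (e₁.trans (Equiv.swap (e₁ univ) ⟨1, h1N⟩)) ∅ = 0 := by
    rw [Equiv.trans_apply, h₁, Equiv.swap_apply_of_ne_of_ne _ h01]
    rw [← h₁]
    exact fun h => hne (e₁.injective h).symm
  rw [hu, h0]
  simp

/-- **`per_n` is a projection of `DET_N`, `2 ^ n = N + 1`, along Grenet's matrix**: for any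
enumeration `e` with `e univ + e ∅` odd, the cells of `Grenet.repr k n e` are variables or
constants and its determinant is `per_n` (`Grenet.isAffineDetRepr_repr`), and
`aeval (fun p => G p.1 p.2) DET_N = det G` (`AlgHom.map_det`,
`Matrix.mvPolynomialX_mapMatrix_aeval`). [cite: Grenet2011, Thm. 1] -/
theorem isDetProjection_of_odd [Nontrivial k] {n N : ℕ} (hn : n ≠ 0) (hN : 2 ^ n = N + 1)
    (e : Finset (Fin n) ≃ Fin (N + 1)) (he : Odd ((e univ : ℕ) + (e ∅ : ℕ))) :
    IsDetProjection (perPoly (Fin n) k) N := by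
  -- adapted from Literature/Computability/AlgebraicComplexity/DeterminantalComplexityProofs.lean
  -- (`exists_isDetProjection`: `aeval (M p.1 p.2) DET_m = det M`)
  refine ⟨fun p => Grenet.repr k n e p.1 p.2, fun p => repr_apply_isVarOrConst k e he p.1 p.2, ?_⟩
  rw [detPoly, AlgHom.map_det, Matrix.mvPolynomialX_mapMatrix_aeval]
  exact (Grenet.isAffineDetRepr_repr k n hn hN e).2.symm

/-- **`per_n` (`n ≥ 1`) is a projection of `DET_N` for `2 ^ n = N + 1`** (Grenet's bound in
Valiant's projection model). [cite: Grenet2011, Thm. 1] -/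
theorem isDetProjection_perPoly [Nontrivial k] {n N : ℕ} (hn : 1 ≤ n) (hN : 2 ^ n = N + 1) :
    IsDetProjection (perPoly (Fin n) k) N := by
  obtain ⟨e, he⟩ := exists_equiv_odd hn hN
  exact isDetProjection_of_odd k (by omega) hN e (by rw [he]; exact odd_one)

/-- **S2 — Grenet's `(2ⁿ - 1) × (2ⁿ - 1)` matrix is a strict projection**: for `n ≥ 1`, `per_n`
is a Valiant projection of `DET_{2ⁿ - 1}` (every cell a variable or a constant), i.e.
`IsDetProjection per_n (2ⁿ - 1)`, whence `pdc(per_n) ≤ 2ⁿ - 1`.  The matrix is `Grenet.repr ℂ n e`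
for an enumeration `e` of the subsets of `Fin n` with `e univ + e ∅` odd, whose cells are
`X (j, |S|)` (row `S`, column `insert j S`), `-1` (diagonal) and `0`. [cite: Grenet2011, Thm. 1] -/
theorem stub_grenetProjection :
    ∀ n : ℕ, 1 ≤ n → IsDetProjection (perPoly (Fin n) ℂ) (2 ^ n - 1) := by
  intro n hn
  obtain ⟨N, hN⟩ : ∃ N, 2 ^ n = N + 1 := ⟨2 ^ n - 1, by have := @Nat.one_le_two_pow n; omega⟩
  rw [hN, Nat.add_sub_cancel]
  exact isDetProjection_perPoly ℂ hn hN

end Summit.ValiantsHypothesis.ValiantsHypothesis.Theorems.ProjectionStabilityOptStep.GrenetProjection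

end
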